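import Summits.AtomisticToContinuum.HydrodynamicLimit.Theorems.AntiMazurCoboundariesCorrectorPressureDecayKiferFreeCountVariance
import Summits.AtomisticToContinuum.HydrodynamicLimit.Theorems.AntiMazurCoboundariesCorrectorPressureDecayKiferFreeBoxMeanCount

/-!
# The particle number of a free low-activity hard-sphere box of any side has variance `O(volume)` (line `FirstLemma`, crux stmt-AtomisticToContinuum-14135)

Registered stub `c9_free_box_count_variance_le` (lead seat c9; piece (B2') of the thermodynamic step of the Gibbs route
of `stub_tangentEntropyBoundUniformGibbs`, the general-box version of (B2) `c9_free_count_variance_le` needed for the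
shrunk cells of irrational side), namespace `Summit.AtomisticToContinuum.HydrodynamicLimit.Theorems.KiferCompactification`.
No definitions (file-local notations `c9v𝒬 k t = k + t𝟙 + [0,1)³`, `c9vν z β u = z · Leb ⊗ M_β(v-u)dv` as in
`…KiferFreeCountVarianceCore.lean`).

For the free grand-canonical unit-diameter hard-sphere measure `R = γ_Λ(· | ∅) = gibbsSpecMeasure 1 z β u Λ ∅` of the
closed box `Λ = c9Box a ℓ = a + [0, ℓ]³` (`…KiferFreeBoxMeanCount.lean`), `ℓ ≥ 1`, activity `0 < z ≤ 1/64`, `β > 0`: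

  `Var_R(N) = ∫ (N - ∫ N dR)² dR ≤ C · ℓ³`,  `C` independent of `a` and `ℓ`  (`c9_free_box_count_variance_le`).

Proof. By the translation covariance of the free specification (`hsLocalSpec_shift`, through the identification
`c9v_gibbsSpecMeasure_empty_eq_hsLocalSpec`) the free measure of `a + [0,ℓ]³` is the image of the free measure of
`[0,ℓ]³` under the shift by `a` (`c9v_gibbsSpecMeasure_c9Box_eq_map`), which leaves `N` and hence the variance
unchanged; so `a = 0`.  The box `[0,ℓ]³` is COVERED by the `(⌊ℓ⌋+1)³ ≤ 8ℓ³` disjoint unit cubes `k + [0,1)³`,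
`k ∈ {0,…,⌊ℓ⌋}³` (`c9v_c9Box_zero_subset_biUnion`; the cubes may stick out of the box, which is harmless because
`R`-a.s. there is no particle off `Λ × ℝ³`), so `R`-a.s. `N = ∑_k ∑_{i<8} 1{i < N_k}` (packing,
`c9v_toReal_count_univ_eq_sum`), the variance is the double sum of the covariances of these indicator events
(`c9v_variance_eq_sum_cov`), each at most `(3/2)^13 (2/3)^{‖k-k'‖₁}` (`c9_free_cube_count_cov_le`, decorrelation of
the free measure on ANY bounded region), and the lattice double sum is `≤ (⌊ℓ⌋+1)³ · 64 · (3/2)^13 · 6³`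
(`c9v_sum_sum_le_of_le_geom`).

References: D. Ruelle, *Statistical Mechanics: Rigorous Results* (1969), §4.2; M. Michelen, W. Perkins,
arXiv:2109.01094, Thm 25.
-/

noncomputable section

open MeasureTheory ProbabilityTheory Set Filter Topology
open scoped ENNReal NNReal

namespace Summit.AtomisticToContinuum.HydrodynamicLimit.Theorems.KiferCompactification

open Literature.MathematicalPhysics.KineticTheory (V3 hsLocalSpec hsLocalSpec_shift isProbabilityMeasure_hsLocalSpec
  hsLocalSpec_ae_isHardCore hsLocalSpec_empty_ae_restrict_eq_self window_mono shiftEquiv coe_shiftEquiv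
  shift_eq_translate)
open Literature.MathematicalPhysics.KineticTheory.HardSphereDLR (gibbsSpecMeasure)
open Literature.Analysis.FunctionSpaces (PointConfig maxwellianBeta)
open Literature.MathematicalPhysics.StatisticalMechanics (smul_prod_map_add)
open Literature.MathematicalPhysics.StatisticalMechanics.HardSphere (Pos Phase window IsHardCore isHardCore_empty
  mem_window shift shift_empty)

/-- File-local notation: the unit cube `k + t𝟙 + [0,1)³` of the lattice `ℕ³ + t𝟙` (`t ∈ ℝ`). -/
local notation3 (prettyPrint := false) "c9v𝒬 " k:max t:max =>
  ({x : V3 | ∀ i, x i ∈ Set.Ico ((k i : ℝ) + t) ((k i : ℝ) + t + 1)} : Set V3)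

/-- File-local notation: the one-particle intensity `z · Leb ⊗ M_β(v-u)dv` of the grand-canonical hard-sphere gas. -/
local notation3 (prettyPrint := false) "c9vν " z:max β:max u:max =>
  (((Real.toNNReal z) • ((volume : Measure Pos).prod
    ((volume : Measure Pos).withDensity fun v => ENNReal.ofReal (maxwellianBeta β (v - u))))) : Measure Phase)

/-! ## Reduction to the box at the origin -/

/-- The box seen from its lower corner is the box at the origin: `(· + a)⁻¹' (a + [0,ℓ]³) = [0,ℓ]³`. -/
theorem c9v_preimage_add_c9Box (a : V3) (ℓ : ℝ) : (· + a) ⁻¹' c9Box a ℓ = c9Box 0 ℓ := by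
  ext y
  simp only [c9Box, mem_preimage, mem_setOf_eq, PiLp.add_apply, PiLp.zero_apply, zero_add, mem_Icc]
  refine forall_congr' fun i => ?_
  constructor <;> rintro ⟨h1, h2⟩ <;> constructor <;> linarith

/-- **Translation covariance of the free box measure**: the free measure of `a + [0,ℓ]³` is the image under the shift
by `a` of the free measure of `[0,ℓ]³` (Poisson form of both sides, `c9v_gibbsSpecMeasure_empty_eq_hsLocalSpec`, and the
covariance `hsLocalSpec_shift` of the free specification under the intensity-preserving translation `(q,v) ↦ (q+a,v)`). -/
theorem c9v_gibbsSpecMeasure_c9Box_eq_map {z β : ℝ} (hz : 0 < z) (hz1 : z ≤ 1 / 64) (hβ : 0 < β) (u a : V3) (ℓ : ℝ) :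
    gibbsSpecMeasure 1 z β u (c9Box a ℓ) ∅ = (gibbsSpecMeasure 1 z β u (c9Box 0 ℓ) ∅).map (shiftEquiv a) := by
  haveI := c9v_isLocallyFiniteMeasure_intensity z hβ u
  obtain ⟨h0, -, -, -⟩ := c9v_intensity_hypotheses hz hz1 hβ u
  rw [c9v_gibbsSpecMeasure_empty_eq_hsLocalSpec hz.le hβ u (freeBox_measurableSet a ℓ) (freeBox_isBounded a ℓ),
    c9v_gibbsSpecMeasure_empty_eq_hsLocalSpec hz.le hβ u (freeBox_measurableSet 0 ℓ) (freeBox_isBounded 0 ℓ),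
    coe_shiftEquiv, ← c9v_preimage_add_c9Box a ℓ]
  have h := hsLocalSpec_shift (a := a) (σ := 1) h0 (smul_prod_map_add z _ a) (freeBox_measurableSet a ℓ)
    (∅ : PointConfig Phase)
  rwa [shift_empty] at h

/-- **The box at the origin is covered by unit cubes**: `[0,ℓ]³ ⊆ ⋃_{k ∈ {0,…,⌊ℓ⌋}³} (k + [0,1)³)`. -/
theorem c9v_c9Box_zero_subset_biUnion (ℓ : ℝ) :
    c9Box (0 : V3) ℓ ⊆ ⋃ k ∈ Fintype.piFinset (fun _ : Fin 3 => Finset.range (⌊ℓ⌋₊ + 1)), c9v𝒬 k 0 := by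
  intro y hy
  have hy' : ∀ i, 0 ≤ y i ∧ y i ≤ ℓ := fun i => by
    have h := hy i
    rw [PiLp.zero_apply, zero_add, mem_Icc] at h
    exact h
  simp only [mem_iUnion, Fintype.mem_piFinset, Finset.mem_range, exists_prop]
  refine ⟨fun i => ⌊y i⌋₊, fun i => Nat.lt_succ_of_le (Nat.floor_le_floor (hy' i).2), fun i => ?_⟩
  rw [mem_Ico, add_zero]
  exact ⟨Nat.floor_le (hy' i).1, Nat.lt_floor_add_one (y i)⟩

/-! ## The variance bound for general boxes -/

/-- **(B2') The particle number of a free low-activity hard-sphere box of any side `ℓ ≥ 1` has variance `O(ℓ³)`.**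
For `R = gibbsSpecMeasure 1 z β u (c9Box a ℓ) ∅` (closed box `a + [0,ℓ]³`, activity `0 < z ≤ 1/64`, `β > 0`):
`Var_R(N) ≤ C ℓ³` with `C` independent of `a` and `ℓ` — translate to `a = 0`, cover `[0,ℓ]³` by the `(⌊ℓ⌋+1)³ ≤ 8ℓ³`
unit cubes `k + [0,1)³`, write `N` a.s. as the sum of the indicators `1{i < N_k}` (packing; no particle off the box), and
bound the double sum of their covariances by the decorrelation of the free measure (`c9_free_cube_count_cov_le`) and
the factorised geometric lattice sum (`c9v_sum_sum_le_of_le_geom`). -/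
theorem c9_free_box_count_variance_le {z β : ℝ} {u : V3} (hz : 0 < z) (hz1 : z ≤ 1 / 64) (hβ : 0 < β) :
    ∃ C : ℝ, ∀ (a : V3) (ℓ : ℝ), 1 ≤ ℓ →
      ∫ ω, ((((ω.count univ : ℕ∞) : ℝ≥0∞).toReal) -
          ∫ ω', (((ω'.count univ : ℕ∞) : ℝ≥0∞).toReal) ∂(gibbsSpecMeasure 1 z β u (c9Box a ℓ) ∅)) ^ 2
        ∂(gibbsSpecMeasure 1 z β u (c9Box a ℓ) ∅) ≤ C * ℓ ^ 3 := by
  refine ⟨8 * (64 * ((3 / 2) ^ 13 * 6 ^ 3)), fun a ℓ hℓ => ?_⟩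
  haveI := c9v_isLocallyFiniteMeasure_intensity z hβ u
  obtain ⟨h0, -, -, hfin⟩ := c9v_intensity_hypotheses hz hz1 hβ u
  -- reduce to the box at the origin
  rw [c9v_gibbsSpecMeasure_c9Box_eq_map hz hz1 hβ u a ℓ, integral_map_equiv, integral_map_equiv]
  simp only [coe_shiftEquiv, shift_eq_translate, PointConfig.count_translate, Set.preimage_univ]
  have hΛm : MeasurableSet (c9Box (0 : V3) ℓ) := freeBox_measurableSet 0 ℓ
  have hΛb : Bornology.IsBounded (c9Box (0 : V3) ℓ) := freeBox_isBounded 0 ℓ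
  obtain ⟨R₀, hR₀⟩ := hΛb.subset_ball 0
  set P := gibbsSpecMeasure 1 z β u (c9Box (0 : V3) ℓ) ∅ with hPdef
  have hPeq : P = hsLocalSpec 1 (c9vν z β u) (c9Box (0 : V3) ℓ) ∅ :=
    c9v_gibbsSpecMeasure_empty_eq_hsLocalSpec hz.le hβ u hΛm hΛb
  haveI : IsProbabilityMeasure P := hPeq ▸ isProbabilityMeasure_hsLocalSpec _ h0 hΛm
      (ne_top_of_le_ne_top (hfin R₀) (measure_mono (window_mono hR₀))) ((isHardCore_empty 1).restrict _)
  -- a.s. the particle number is the indicator sum over the covering cubes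
  have hNS : ∀ᵐ ω ∂P, ((ω.count univ : ℕ∞) : ℝ≥0∞).toReal =
      ∑ b ∈ (Fintype.piFinset fun _ : Fin 3 => Finset.range (⌊ℓ⌋₊ + 1)) ×ˢ Finset.range 8,
        {ω' : PointConfig Phase | (b.2 : ℕ∞) < ω'.count (c9v𝒬 b.1 0 ×ˢ univ)}.indicator 1 ω := by
    rw [hPeq]
    filter_upwards [hsLocalSpec_ae_isHardCore (c9vν z β u) 1 (c9Box (0 : V3) ℓ) ∅,
      hsLocalSpec_empty_ae_restrict_eq_self (c9vν z β u) 1 hΛm] with ω hhc hcar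
    refine c9v_toReal_count_univ_eq_sum hhc _ 0 ?_
    have hU : window (c9Box (0 : V3) ℓ) ⊆
        ⋃ k ∈ Fintype.piFinset (fun _ : Fin 3 => Finset.range (⌊ℓ⌋₊ + 1)), window (c9v𝒬 k 0) := fun y hy => by
      have h := c9v_c9Box_zero_subset_biUnion ℓ (mem_window.1 hy)
      simp only [mem_iUnion, exists_prop] at h ⊢
      obtain ⟨k, hk, hyk⟩ := h
      exact ⟨k, hk, mem_window.2 hyk⟩
    conv_lhs => rw [← hcar]
    conv_rhs => rw [← hcar]
    rw [PointConfig.count_restrict, PointConfig.count_restrict, inter_univ, inter_eq_left.2 hU]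
  -- variance = double sum of covariances ≤ lattice sum ≤ 8 ℓ³ · 64 · (3/2)^13 · 6³
  rw [c9v_variance_eq_sum_cov P _ (fun b _ => c9v_measurableSet_countEvent (c9v_measurableSet_cube _ _) _) hNS]
  refine (c9v_sum_sum_le_of_le_geom (⌊ℓ⌋₊ + 1) fun b b' => (le_abs_self _).trans
    (c9_free_cube_count_cov_le hz hz1 hβ hΛm hΛb 0 b.1 b'.1 b.2 b'.2)).trans ?_
  have hL : (((⌊ℓ⌋₊ + 1 : ℕ)) : ℝ) ≤ 2 * ℓ := by
    push_cast
    linarith [Nat.floor_le (by linarith : (0 : ℝ) ≤ ℓ)]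
  calc (((⌊ℓ⌋₊ + 1 : ℕ)) : ℝ) ^ 3 * (64 * ((3 / 2) ^ 13 * 6 ^ 3)) ≤ (2 * ℓ) ^ 3 * (64 * ((3 / 2) ^ 13 * 6 ^ 3)) := by
        gcongr
    _ = 8 * (64 * ((3 / 2) ^ 13 * 6 ^ 3)) * ℓ ^ 3 := by ring

end Summit.AtomisticToContinuum.HydrodynamicLimit.Theorems.KiferCompactification

end
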